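import Summits.BirchSwinnertonDyer.BirchSwinnertonDyer.Theorems.SignedLowerHalvesSmallImageLowerHalfBothSignsMuRiderNode
import Summits.BirchSwinnertonDyer.BirchSwinnertonDyer.Theorems.PrintX8LayeredStevensCollapse
import Summits.BirchSwinnertonDyer.BirchSwinnertonDyer.Theorems.PrintX8LayeredStevensBridge
import HarnessLib

/-!
# Route `SignedLowerHalves`, child crux L `SmallImageLowerHalfBothSigns` (item stmt-BirchSwinnertonDyer-23599), line
# `birth_acns` v14, stub `stub_muBothSigns_ns`: the `p = 3` SECOND SIGN of the both-signs rider reduces to the two-layer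
# cyclotomic winding span of route `PrintX8`'s line «layered Stevens at 3» — the `a₃ = 0` twin of x8's `collapseLS`
# (cell `bsd-ssimc`, width seat `bsd-line-slh-p3-w2` gen 2 under LEAD slh-p3; helper `--supports 23599`; THEOREMS ONLY; part 2 of 2)

HONEST FRAMING.  Child L, crux 4 and BSD are OPEN and NOT proved by anything here; no definition, no named fact, no
`sorry`.  DISPLAYED antecedents: the two-layer winding carrier `Rank1Residual.CycWindingUnitTwoLayersAt W p`, the
single-layer span predicates `LayerEisSpanModGen N p m` / `LayerEisSpanTwoModGen N p` (Sun 2007 §4 Conj. 8 at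
`(ℓ, p) = (3, 3)`, Eisenstein-refined; OPEN; per level an `𝔽₃`-rank computation), the conjecture node `SignedMuVanishing W p`.

* §1 (`p = 3`, any curve with good reduction at `3` and `a₃ = 0` — no class / CM / image hypothesis): unit winding-symbol
  differences `[b/3ᵐ]⁺_f − [0]⁺_f`, `[b'/3^{m+1}]⁺_f − [0]⁺_f` at TWO CONSECUTIVE layers give BOTH colours `μ = 0` with
  unit content (`forall_chromaticL_muZero_of_twoLayers_of_frobeniusTrace_eq_zero`, x8's proof with
  `isUnit_chromaticL_of_frobeniusTrace_eq_zero` in the unit case), hence the rider at that pair in its own currency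
  (`forall_sign_exists_signed_hasUnitContent_of_twoLayers_three`, any level; the per-pair CERTIFICATE form of
  `stub_muBothSigns_ns` at `p = 3`), the node (`signedMuVanishing_three_of_cycWindingUnitTwoLayersAt` — with x8's
  `collapseLS` this covers the whole `3`-supersingular axis), and the same from two CERTIFIED layers at the level of the
  newform through x8's PROVED bridge LS-B `PrintX8VerticalStevens.cycWindingUnitTwoLayersAt_three_of_goodSS`.
* §2 (class-wide): the `p = 3` slice of the rider for EVERY curve with `a₃ = 0` from the single hypothesis LS-0(3)
  «every level prime to `3` satisfies LAYER-EIS-SPAN mod `3` at all large layers»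
  (`forall_sign_exists_signed_hasUnitContent_three_of_layeredStevensModAtThree`), and the registered stub's text from
  LS-0(3) ∧ «the node at the `p ≥ 5` pairs of the domain» (`muBothSigns_of_layeredStevensModAtThree_of_signedMuVanishing`).
  READING FOR THE PEN (D-0014, numbers): on the 100 `p = 3` pairs of the 136-pair census of child L's domain the open
  content of the second sign is ONE group-theoretic statement SHARED with route PrintX8's crux 20714, not a new
  conjecture; the tree's all-layer THEOREM B (`ConjSpanGen`, Vaserstein) gives one layer, hence one sign
  (`LargeImageMuFloor.signedMuFloor_three`), and cannot see the parity of the layer; at `p ≥ 5` one sign is Conjecture B⁰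
  (`TeichSpanGenAll`), the second would need a two-layer TEICHMÜLLER-averaged span (no vocabulary in the tree).

References: [PerrinRiou2003] §6.1 Conj. 6.1.1; [Pollack2003] Def. 6.15, Prop. 6.9–6.10, Prop. 6.18; [Sprung2017] §3.1, Cor. 4.10;
[Kurihara2002] Thm. 0.1; [Sun2007] §4 (8), Conj. 8; [Manin1972] Prop. 1.4; [MazurTateTeitelbaum1986Invent] §I.4 (4.2), §I.10 (10.1);
[Kobayashi2003] Thm. 3.2, (3.4)–(3.6); tree: `Theorems/PrintX8LayeredStevensCollapse.lean` / `…Bridge.lean` (bsd-print-x8 p3/p1),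
`Rank1Residual/CyclotomicWindingSpan.lean` §3 (x8 ty2), part 1 `…MuRiderNode.lean`.
-/

-- D-0017: single-problem summit, the namespace repeats the problem name by design.
set_option linter.dupNamespace false
set_option autoImplicit false

noncomputable section

open scoped Classical MatrixGroups ModularForm

open CongruenceSubgroup Polynomial WeierstrassCurve Literature.NumberTheory.EllipticCurves
  Literature.NumberTheory.EllipticCurves.ModularForms
  Literature.NumberTheory.EllipticCurves.Sprung2017
  Literature.NumberTheory.EllipticCurves.Kobayashi2003
  Literature.NumberTheory.EllipticCurves.GreenbergVatsal2000
  Literature.NumberTheory.EllipticCurves.Rank1Residual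
  Summit.BirchSwinnertonDyer.Rank1Residual.X1.MuLambda
  Summit.BirchSwinnertonDyer.Rank1Residual.Supersingular
  Summit.BirchSwinnertonDyer.BirchSwinnertonDyer.Theorems.PrintX8MazurTateMuRider
  Summit.BirchSwinnertonDyer.BirchSwinnertonDyer.Theorems.PrintX8MazurTateThreeCollapse
  Summit.BirchSwinnertonDyer.BirchSwinnertonDyer.Theorems.PrintX8LayeredStevensCollapse
  Summit.BirchSwinnertonDyer.BirchSwinnertonDyer.Theorems.SmallImageLowerHalfBothSignsMuRiderNode

namespace Summit.BirchSwinnertonDyer.BirchSwinnertonDyer.Theorems.SmallImageLowerHalfBothSignsMuRiderTwoLayersThree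

/-! ## §1 `p = 3`: two consecutive layers ⟹ BOTH signs, for every curve with good reduction at `3` and `a₃ = 0` -/

section TwoLayersThree

variable {W : WeierstrassCurve ℚ} [W.IsElliptic] [W.IsGloballyMinimal] {N : ℕ} [NeZero N]
  {f : CuspForm (Gamma0 N) 2} {p : ℕ} [hp : Fact p.Prime]

/-- **THE COLLAPSE AT TWO LAYERS for `a₃ = 0`** (the twin of `ClassX8.forall_chromaticL_muZero_of_twoLayers`, cell
`bsd-print-x8`, which treats `a₃ = ±3`).  `p = 3` good for `W` with `a₃ = 0`, `f` ANY newform of `W` (level `N`), `(L♯, L♭)`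
ANY Sprung pair (= Pollack pair) of `f` at `3`; if `m ≥ 1` and `b, b' ∈ ℤ` prime to `3` have
`‖[b/3ᵐ]⁺_f − [0]⁺_f‖₃ ≥ 1` and `‖[b'/3^{m+1}]⁺_f − [0]⁺_f‖₃ ≥ 1`, then EVERY colour has `L^• ≠ 0`, `μ(L^•) = 0`, unit
content and `μ(Λ/(L^•)) = 0`.  Proof = x8's: all symbols are `3`-integral (`a₃ = 0 ≢ 1`); if `[0]⁺_f` is a unit both
colours are units (`isUnit_chromaticL_of_frobeniusTrace_eq_zero`); otherwise the two layer symbols are units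
(ultrametric pinch), so the integral models of `θ_{m−1}`, `θ_m` are `≢ 0 (mod 3)` — one index odd, one even — and
`forall_chromaticL_muZero_of_mazurTate_odd_even` gives both colours.
[cite: Pollack2003, Def. 6.15, Prop. 6.9 and Prop. 6.10] [cite: Sprung2017, §3.1 and Cor. 4.10] [cite: Kurihara2002, Thm. 0.1] -/
theorem forall_chromaticL_muZero_of_twoLayers_of_frobeniusTrace_eq_zero (hp3 : p = 3)
    (hgood : W.HasGoodReductionAtPrime p) (hap0 : W.frobeniusTrace p = 0) (hf : IsNewformOf W f)
    {Lsharp Lflat : IwasawaAlgebra p} (hSP : IsSprungPair f p (W.frobeniusTrace p) Lsharp Lflat)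
    {m : ℕ} (hm : 1 ≤ m) {b b' : ℤ} (hb : ¬ (p : ℤ) ∣ b) (hb' : ¬ (p : ℤ) ∣ b')
    (h1 : 1 ≤ ‖((ratPlusSymbol f ((b : ℚ) / (p : ℚ) ^ m) - ratPlusSymbol f 0 : ℚ) : ℚ_[p])‖)
    (h2 : 1 ≤ ‖((ratPlusSymbol f ((b' : ℚ) / (p : ℚ) ^ (m + 1)) - ratPlusSymbol f 0 : ℚ) : ℚ_[p])‖)
    (c : Chroma) :
    chromaticL c Lsharp Lflat ≠ 0 ∧ mu (chromaticL c Lsharp Lflat) = 0 ∧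
      HasUnitContent (chromaticL c Lsharp Lflat) ∧
      muInvariant p (IwasawaAlgebra p ⧸ Ideal.span {chromaticL c Lsharp Lflat}) = 0 := by
  -- it suffices to produce `red L^• ≠ 0`
  suffices hred : red (chromaticL c Lsharp Lflat) ≠ 0 from
    ⟨ne_zero_of_red_ne_zero hred, (mu_eq_zero_and_lam_eq_of_red_ne_zero hred).1,
      hasUnitContent_of_red_ne_zero hred, muInvariant_quotient_span_eq_zero_of_red_ne_zero hred⟩
  subst hp3
  have hp2 : (3 : ℕ) ≠ 2 := by decide
  have hap3 : ((3 : ℕ) : ℤ) ∣ W.frobeniusTrace 3 := by rw [hap0]; exact dvd_zero _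
  have hf0 : IsNewform0 f := hf.1
  have hpN : ¬ 3 ∣ N := not_dvd_level_of_isNewformOf hf hgood
  have hap : cuspCoeff f 3 = ((W.frobeniusTrace 3 : ℤ) : ℂ) :=
    cuspCoeff_eq_frobeniusTrace_of_isNewformOf_holds hf hgood
  have hpa : ¬ ((3 : ℕ) : ℤ) ∣ W.frobeniusTrace 3 - 1 := by
    rw [hap0]
    norm_num
  have he : cyclotomicExponent 3 = 1 := if_neg hp2
  by_cases h0 : ‖((ratPlusSymbol f 0 : ℚ) : ℚ_[3])‖ = 1
  · -- the unit case: both colours are units of `Λ`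
    have hr : ratPlusSymbol f 0 ≠ 0 := by
      intro hz
      rw [hz, Rat.cast_zero, norm_zero] at h0
      exact zero_ne_one h0
    have hv : padicValRat 3 (ratPlusSymbol f 0) = 0 := by
      rw [Padic.eq_padicNorm, padicNorm.eq_zpow_of_nonzero hr] at h0
      have h0' : ((3 : ℚ) ^ (-padicValRat 3 (ratPlusSymbol f 0)) : ℚ) = 1 := by exact_mod_cast h0
      have h3 := (zpow_eq_one_iff_right₀ (by norm_num : (0 : ℚ) ≤ 3) (by norm_num : (3 : ℚ) ≠ 1)).mp h0'
      omega
    exact ((isUnit_chromaticL_of_frobeniusTrace_eq_zero hp2 hf hgood hap0 hSP c hr hv).map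
      (PowerSeries.map (IsLocalRing.residue ℤ_[3]))).ne_zero
  · -- both layer symbols are units
    have h0lt : ‖((ratPlusSymbol f 0 : ℚ) : ℚ_[3])‖ < 1 := by
      refine lt_of_le_of_ne ?_ h0
      have h := norm_ratPlusSymbol_div_pow_le_one_of_not_dvd hp2 hf0 hpN hap hpa 0 0
      simpa using h
    -- layer `m`: the symbol `[b/3ᵐ]⁺`
    have hu1 : ‖((ratPlusSymbol f ((((b : ZMod (3 ^ m)).val : ℕ) : ℚ) / ((3 : ℕ) : ℚ) ^ m) : ℚ) :
        ℚ_[3])‖ = 1 := by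
      rw [← ratPlusSymbol_intCast_div_pow_eq_val f 3 m b]
      rw [Rat.cast_sub] at h1
      exact norm_eq_one_of_one_le_norm_sub 3
        (by rw [ratPlusSymbol_intCast_div_pow_eq_val f 3 m b]
            exact norm_ratPlusSymbol_div_pow_le_one_of_not_dvd hp2 hf0 hpN hap hpa _ _) h0lt h1
    -- layer `m + 1`: the symbol `[b'/3^{m+1}]⁺`
    have hu2 : ‖((ratPlusSymbol f ((((b' : ZMod (3 ^ (m + 1))).val : ℕ) : ℚ) /
        ((3 : ℕ) : ℚ) ^ (m + 1)) : ℚ) : ℚ_[3])‖ = 1 := by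
      rw [← ratPlusSymbol_intCast_div_pow_eq_val f 3 (m + 1) b']
      rw [Rat.cast_sub] at h2
      exact norm_eq_one_of_one_le_norm_sub 3
        (by rw [ratPlusSymbol_intCast_div_pow_eq_val f 3 (m + 1) b']
            exact norm_ratPlusSymbol_div_pow_le_one_of_not_dvd hp2 hf0 hpN hap hpa _ _) h0lt h2
    -- integral models of `θ_{m-1}` and `θ_m`, both `≢ 0 (mod 3)`
    obtain ⟨n, rfl⟩ : ∃ n, m = n + 1 := ⟨m - 1, by omega⟩
    obtain ⟨P₁, hP₁⟩ := exists_map_eq_map_mazurTateElement_of_not_dvd hp2 hf0 hpN hap hpa n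
    obtain ⟨P₂, hP₂⟩ := exists_map_eq_map_mazurTateElement_of_not_dvd hp2 hf0 hpN hap hpa (n + 1)
    have hΘ₁ : iwasawaToPowerSeries 3 (P₁ : PowerSeries ℤ_[3]) =
        ((mazurTateElement f 3 n).map (algebraMap ℚ ℚ_[3]) : PowerSeries ℚ_[3]) := by
      rw [← hP₁, Polynomial.polynomial_map_coe]
    have hΘ₂ : iwasawaToPowerSeries 3 (P₂ : PowerSeries ℤ_[3]) =
        ((mazurTateElement f 3 (n + 1)).map (algebraMap ℚ ℚ_[3]) : PowerSeries ℚ_[3]) := by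
      rw [← hP₂, Polynomial.polynomial_map_coe]
    have hred₁ : red (P₁ : PowerSeries ℤ_[3]) ≠ 0 :=
      red_ne_zero_of_mazurTate_of_norm_ratPlusSymbol_eq_one f rfl hf0 hpN hap hpa hΘ₁
        (not_dvd_val_intCast 3 (L := n + 1) (by omega) hb) (by rw [he]; exact hu1)
    have hred₂ : red (P₂ : PowerSeries ℤ_[3]) ≠ 0 :=
      red_ne_zero_of_mazurTate_of_norm_ratPlusSymbol_eq_one f rfl hf0 hpN hap hpa hΘ₂
        (not_dvd_val_intCast 3 (L := n + 1 + 1) (by omega) hb') (by rw [he]; exact hu2)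
    have hΘ₁0 := ne_zero_of_red_ne_zero hred₁
    have hμ₁ := (mu_eq_zero_and_lam_eq_of_red_ne_zero hred₁).1
    have hΘ₂0 := ne_zero_of_red_ne_zero hred₂
    have hμ₂ := (mu_eq_zero_and_lam_eq_of_red_ne_zero hred₂).1
    -- one of `n`, `n + 1` is odd, the other even
    have key : ∀ c' : Chroma, chromaticL c' Lsharp Lflat ≠ 0 ∧ mu (chromaticL c' Lsharp Lflat) = 0 ∧
        HasUnitContent (chromaticL c' Lsharp Lflat) ∧
        muInvariant 3 (IwasawaAlgebra 3 ⧸ Ideal.span {chromaticL c' Lsharp Lflat}) = 0 := by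
      intro c'
      rcases Nat.even_or_odd n with hn | hn
      · have hn1 : Odd (n + 1) := hn.add_one
        exact forall_chromaticL_muZero_of_mazurTate_odd_even hp2 hf hgood hap3 hSP hn1 hn hΘ₂ hΘ₂0 hμ₂
          hΘ₁ hΘ₁0 hμ₁ c'
      · have hn1 : Even (n + 1) := hn.add_one
        exact forall_chromaticL_muZero_of_mazurTate_odd_even hp2 hf hgood hap3 hSP hn hn1 hΘ₁ hΘ₁0 hμ₁
          hΘ₂ hΘ₂0 hμ₂ c'
    obtain ⟨hne, hmu, -, -⟩ := key c
    exact red_ne_zero_of_mu_eq_zero hne hmu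

/-- **Two layers ⟹ the BOTH-signs rider at that pair, in the stub's own currency** (`p = 3` good, `a₃ = 0`, `f` ANY
newform of `W`): `∀ ε, ∃ L₀, IsSignedPAdicLFunction f 3 ε L₀ ∧ HasUnitContent L₀` — `L₀ = kobayashiL ε L⁺ L⁻` of a
Pollack pair (exists by the tree THEOREM `pollack_exists_plusMinusPAdicLFunction_holds`; a Pollack pair is a Sprung
pair at trace `0`, `isSprungPair_zero_iff`).  This is the per-pair CERTIFICATE form of `stub_muBothSigns_ns` at
`p = 3`: two unit winding-symbol differences at consecutive layers. [cite: Pollack2003, Prop. 6.9, Prop. 6.10 and Prop. 6.18]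
[cite: Kobayashi2003, Thm. 3.2 and (3.4)–(3.6) (p. 7)] [cite: MazurTateTeitelbaum1986Invent, §I.10 (10.1)] -/
theorem forall_sign_exists_signed_hasUnitContent_of_twoLayers_three (hp3 : p = 3)
    (hgood : W.HasGoodReductionAtPrime p) (hap0 : W.frobeniusTrace p = 0) (hf : IsNewformOf W f)
    {m : ℕ} (hm : 1 ≤ m) {b b' : ℤ} (hb : ¬ (p : ℤ) ∣ b) (hb' : ¬ (p : ℤ) ∣ b')
    (h1 : 1 ≤ ‖((ratPlusSymbol f ((b : ℚ) / (p : ℚ) ^ m) - ratPlusSymbol f 0 : ℚ) : ℚ_[p])‖)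
    (h2 : 1 ≤ ‖((ratPlusSymbol f ((b' : ℚ) / (p : ℚ) ^ (m + 1)) - ratPlusSymbol f 0 : ℚ) : ℚ_[p])‖)
    (ε : ℤˣ) : ∃ L₀ : IwasawaAlgebra p, IsSignedPAdicLFunction f p ε L₀ ∧ HasUnitContent L₀ := by
  have hp2 : p ≠ 2 := by omega
  obtain ⟨Lplus, Lminus, hPP⟩ :=
    exists_isPollackPair pollack_exists_plusMinusPAdicLFunction_holds hp2 hf hgood hap0
  have hSP : IsSprungPair f p (W.frobeniusTrace p) Lplus Lminus := by
    rw [hap0]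
    exact (isSprungPair_zero_iff f p Lplus Lminus).mpr ⟨hPP.2.2.1, hPP.2.2.2⟩
  refine ⟨kobayashiL ε Lplus Lminus, hPP.isSignedPAdicLFunction_kobayashiL ε, ?_⟩
  rcases Int.units_eq_one_or ε with rfl | rfl
  · have h := (forall_chromaticL_muZero_of_twoLayers_of_frobeniusTrace_eq_zero hp3 hgood hap0 hf hSP hm hb
      hb' h1 h2 .flat).2.2.1
    rw [chromaticL_flat] at h
    rw [kobayashiL, if_pos rfl]
    exact h
  · have h := (forall_chromaticL_muZero_of_twoLayers_of_frobeniusTrace_eq_zero hp3 hgood hap0 hf hSP hm hb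
      hb' h1 h2 .sharp).2.2.1
    rw [chromaticL_sharp] at h
    have hne : ((-1 : ℤˣ) = 1) ↔ False := by decide
    rw [kobayashiL, if_neg hne.mp]
    exact h

/-- **The two-layer carrier `CycWindingUnitTwoLayersAt W 3` ⟹ the both-signs rider at every newform of `W`** (`a₃ = 0`).
[cite: MazurTateTeitelbaum1986Invent, §I.10 (10.1)] [cite: Pollack2003, Prop. 6.9 and Prop. 6.10] -/
theorem forall_sign_exists_signed_hasUnitContent_of_cycWindingUnitTwoLayersAt_three (hp3 : p = 3)
    (hgood : W.HasGoodReductionAtPrime p) (hap0 : W.frobeniusTrace p = 0) (hLS : CycWindingUnitTwoLayersAt W p)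
    (hf : IsNewformOf W f) (ε : ℤˣ) :
    ∃ L₀ : IwasawaAlgebra p, IsSignedPAdicLFunction f p ε L₀ ∧ HasUnitContent L₀ := by
  obtain ⟨m, b, b', hm, hb, hb', h1, h2⟩ := hLS f hf
  exact forall_sign_exists_signed_hasUnitContent_of_twoLayers_three hp3 hgood hap0 hf hm hb hb' h1 h2 ε

/-- **`a₃ = 0` twin of x8's `collapseLS`: `CycWindingUnitTwoLayersAt W 3 ⟹ SignedMuVanishing W 3`** for every curve with
good reduction at `3` and `a₃ = 0` (with `PrintX8LayeredStevensCollapse.collapseLS` this covers the whole `3`-supersingular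
axis `GoodSS W 3`). [cite: PerrinRiou2003, §6.1 Conjecture 6.1.1] [cite: Sun2007, §4 Conj. 8] [cite: Pollack2003, Prop. 6.9 and Prop. 6.10] -/
theorem signedMuVanishing_three_of_cycWindingUnitTwoLayersAt (hp3 : p = 3)
    (hgood : W.HasGoodReductionAtPrime p) (hap0 : W.frobeniusTrace p = 0) (hLS : CycWindingUnitTwoLayersAt W p) :
    SignedMuVanishing W p := by
  intro hN f₀ hf₀ Lsharp Lflat hSP c
  haveI := hN
  obtain ⟨m, b, b', hm, hb, hb', h1, h2⟩ := hLS f₀ hf₀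
  obtain ⟨hne, hmu, -, -⟩ :=
    forall_chromaticL_muZero_of_twoLayers_of_frobeniusTrace_eq_zero hp3 hgood hap0 hf₀ hSP hm hb hb' h1 h2 c
  exact ⟨hne, hmu⟩

/-- **Two CERTIFIED layers at the level of every newform ⟹ the both-signs rider** (`p = 3` good, `a₃ = 0`): the x8 bridge
LS-B `PrintX8VerticalStevens.cycWindingUnitTwoLayersAt_three_of_goodSS` (PROVED; `GoodSS W 3` holds since `3 ∣ a₃ = 0`) turns
`LayerEisSpanTwoModGen N 3` at the level of each newform into the two-layer carrier.  Per level `N` the hypothesis is an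
`𝔽₃`-rank computation at two consecutive layers (`LayerEisSpanModGen N 3 m`, `m+1`).
[cite: Sun2007, §4 (8) and Conj. 8] [cite: Manin1972, Prop. 1.4] [cite: MazurTateTeitelbaum1986Invent, §I.10 (10.1)] -/
theorem forall_sign_exists_signed_hasUnitContent_three_of_layerEisSpanTwoModGen (hp3 : p = 3)
    (hgood : W.HasGoodReductionAtPrime p) (hap0 : W.frobeniusTrace p = 0)
    (hL : ∀ {M : ℕ} [NeZero M] (g : CuspForm (Gamma0 M) 2), IsNewformOf W g → LayerEisSpanTwoModGen M p)
    (hf : IsNewformOf W f) (ε : ℤˣ) :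
    ∃ L₀ : IwasawaAlgebra p, IsSignedPAdicLFunction f p ε L₀ ∧ HasUnitContent L₀ := by
  subst hp3
  exact forall_sign_exists_signed_hasUnitContent_of_cycWindingUnitTwoLayersAt_three rfl hgood hap0
    (PrintX8VerticalStevens.cycWindingUnitTwoLayersAt_three_of_goodSS W ⟨hgood, by rw [hap0]; exact dvd_zero _⟩ hL)
    hf ε

/-- **The node at `3` from two certified layers** (`a₃ = 0`). [cite: PerrinRiou2003, §6.1 Conjecture 6.1.1] [cite: Sun2007, §4 Conj. 8] -/
theorem signedMuVanishing_three_of_layerEisSpanTwoModGen (hp3 : p = 3)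
    (hgood : W.HasGoodReductionAtPrime p) (hap0 : W.frobeniusTrace p = 0)
    (hL : ∀ {M : ℕ} [NeZero M] (g : CuspForm (Gamma0 M) 2), IsNewformOf W g → LayerEisSpanTwoModGen M p) :
    SignedMuVanishing W p := by
  subst hp3
  exact signedMuVanishing_three_of_cycWindingUnitTwoLayersAt rfl hgood hap0
    (PrintX8VerticalStevens.cycWindingUnitTwoLayersAt_three_of_goodSS W ⟨hgood, by rw [hap0]; exact dvd_zero _⟩ hL)

end TwoLayersThree

/-! ## §2 Class-wide: the `p = 3` slice of the stub from LS-0(3) alone; the whole stub from LS-0(3) ∧ the node at `p ≥ 5` -/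

section ClassWide

/-- **LS-0(3) ⟹ the `p = 3` slice of the both-signs rider for EVERY curve with good reduction at `3` and `a₃ = 0`**
(no class / CM / image hypothesis — so in particular at the 100 `p = 3` pairs of child L's domain).  LS-0(3) =
«every level `M ≥ 1` prime to `3` satisfies LAYER-EIS-SPAN mod `3` at every layer `m ≥ m₀(M)`» (the planner's
`LayeredStevensModAt 3` of route PrintX8's line «layered Stevens at 3», = Sun 2007 Conj. 8 at `(ℓ, p) = (3, 3)` mod `3`,
Eisenstein-refined — OPEN, here a HYPOTHESIS).  Two consecutive large layers at the level of the newform (`3 ∤ N` by good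
reduction) feed §3. [cite: Sun2007, §4 Conj. 8] [cite: PerrinRiou2003, §6.1 Conjecture 6.1.1] -/
theorem forall_sign_exists_signed_hasUnitContent_three_of_layeredStevensModAtThree
    (hLSM : ∀ M : ℕ, 0 < M → ¬ 3 ∣ M → ∃ m₀ : ℕ, ∀ m : ℕ, m₀ ≤ m → LayerEisSpanModGen M 3 m)
    (W : WeierstrassCurve ℚ) [W.IsElliptic] [W.IsGloballyMinimal] (p : ℕ) [Fact p.Prime] (hp3 : p = 3)
    (hgood : W.HasGoodReductionAtPrime p) (hap0 : W.frobeniusTrace p = 0)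
    {N : ℕ} [NeZero N] {f : CuspForm (Gamma0 N) 2} (hf : IsNewformOf W f) (ε : ℤˣ) :
    ∃ L₀ : IwasawaAlgebra p, IsSignedPAdicLFunction f p ε L₀ ∧ HasUnitContent L₀ := by
  subst hp3
  have hL : ∀ {M : ℕ} [NeZero M] (g : CuspForm (Gamma0 M) 2), IsNewformOf W g → LayerEisSpanTwoModGen M 3 := by
    intro M _ g hg
    obtain ⟨m₀, hm₀⟩ := hLSM M (Nat.pos_of_ne_zero (NeZero.ne M)) (not_dvd_level_of_isNewformOf hg hgood)
    exact ⟨m₀ + 1, by omega, hm₀ _ (by omega), hm₀ _ (by omega)⟩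
  -- `show` resets the goal annotation left by `have` (needed before passing the implicit-binder hypothesis `hL`)
  show ∃ L₀ : IwasawaAlgebra 3, IsSignedPAdicLFunction f 3 ε L₀ ∧ HasUnitContent L₀
  exact forall_sign_exists_signed_hasUnitContent_three_of_layerEisSpanTwoModGen rfl hgood hap0 hL hf ε

/-- **LS-0(3) ⟹ `SignedMuVanishing W 3` for every curve with good reduction at `3` and `a₃ = 0`** (with x8's
`ClassX8.signedMuVanishing_of_bridgeLS_of_layeredStevens`: on the whole `3`-supersingular axis).
[cite: Sun2007, §4 Conj. 8] [cite: PerrinRiou2003, §6.1 Conjecture 6.1.1] -/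
theorem signedMuVanishing_three_of_layeredStevensModAtThree
    (hLSM : ∀ M : ℕ, 0 < M → ¬ 3 ∣ M → ∃ m₀ : ℕ, ∀ m : ℕ, m₀ ≤ m → LayerEisSpanModGen M 3 m)
    (W : WeierstrassCurve ℚ) [W.IsElliptic] [W.IsGloballyMinimal] (p : ℕ) [Fact p.Prime] (hp3 : p = 3)
    (hgood : W.HasGoodReductionAtPrime p) (hap0 : W.frobeniusTrace p = 0) : SignedMuVanishing W p := by
  subst hp3
  have hL : ∀ {M : ℕ} [NeZero M] (g : CuspForm (Gamma0 M) 2), IsNewformOf W g → LayerEisSpanTwoModGen M 3 := by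
    intro M _ g hg
    obtain ⟨m₀, hm₀⟩ := hLSM M (Nat.pos_of_ne_zero (NeZero.ne M)) (not_dvd_level_of_isNewformOf hg hgood)
    exact ⟨m₀ + 1, by omega, hm₀ _ (by omega), hm₀ _ (by omega)⟩
  show SignedMuVanishing W 3
  exact signedMuVanishing_three_of_layerEisSpanTwoModGen rfl hgood hap0 hL

/-- **ASSEMBLY: the registered stub's text from LS-0(3) and the node at the `p ≥ 5` pairs of the domain.**  The `p = 3`
pairs need NO `μ`-input beyond the two-layer span hypothesis LS-0(3) shared with route PrintX8; the `p ≥ 5` pairs carry the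
node `SignedMuVanishing W p` itself (ONE sign of which is Conjecture B⁰ `TeichSpanGenAll` by
`LargeImageMuFloor.signedMuFloor_of_teichSpanGenAll_of_five_le`; the second sign would need a two-layer TEICHMÜLLER-averaged
span, not in the tree's vocabulary). [cite: Sun2007, §4 Conj. 8] [cite: PerrinRiou2003, §6.1 Conjecture 6.1.1] [cite: PollackWeston2011, Rem. 4.2] -/
theorem muBothSigns_of_layeredStevensModAtThree_of_signedMuVanishing
    (hLSM : ∀ M : ℕ, 0 < M → ¬ 3 ∣ M → ∃ m₀ : ℕ, ∀ m : ℕ, m₀ ≤ m → LayerEisSpanModGen M 3 m)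
    (h5 : ∀ (W : WeierstrassCurve ℚ) [W.IsElliptic] [W.IsGloballyMinimal] (p : ℕ) [Fact p.Prime],
      5 ≤ p → ClassX7 W p → ¬ W.HasCM → W.frobeniusTrace p = 0 → ¬ Surj W p → SignedMuVanishing W p) :
    ∀ (W : WeierstrassCurve ℚ) [W.IsElliptic] [W.IsGloballyMinimal] (p : ℕ) [Fact p.Prime],
      p ≠ 2 → ClassX7 W p → ¬ W.HasCM → W.frobeniusTrace p = 0 → ¬ Surj W p →
      ∀ [NeZero (W.conductorNorm ℤ)] (f : CuspForm (Gamma0 (W.conductorNorm ℤ)) 2),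
      IsNewformOf W f → ∀ ε : ℤˣ, ∃ L₀ : IwasawaAlgebra p,
        IsSignedPAdicLFunction f p ε L₀ ∧ HasUnitContent L₀ := by
  intro W _ _ p _ hp2 hX hCM hap hs _ f hf ε
  by_cases hp3 : p = 3
  · exact forall_sign_exists_signed_hasUnitContent_three_of_layeredStevensModAtThree hLSM W p hp3 hX.1.1 hap
      hf ε
  · have hpP : p.Prime := Fact.out
    have hp5 : 5 ≤ p := hpP.five_le_of_ne_two_of_ne_three hp2 hp3
    exact forall_sign_exists_signed_hasUnitContent_of_signedMuVanishing (h5 W p hp5 hX hCM hap hs) hp2 hX.1.1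
      hap hf ε

end ClassWide

end Summit.BirchSwinnertonDyer.BirchSwinnertonDyer.Theorems.SmallImageLowerHalfBothSignsMuRiderTwoLayersThree

end
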